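import Literature.Barriers.QuantumAdvantage.TensorNetworkContraction
import Literature.Computability.QuantumComplexity.LightConeMachineMain
import HarnessLib

/-!
# Discharge of `markovShi2008_cor15_anyOrder`: logarithmic-depth local Clifford+T families (any wire ordering) decide only languages in `P`

Sibling proof file of `Barriers/QuantumAdvantage/TensorNetworkContraction.lean` (D-0014: the facts
stay `def`s). `markovShi2008_cor15_anyOrder` is the language-level reading of Markov–Shi 2008,
Corollary 1.5 ("a polynomial-size local-interacting circuit with a logarithmic depth ... can be
simulated deterministically in polynomial time"): a language decided with error `≤ 1/3` by a
poly-time uniform, polynomial-size, oracle-free Clifford+`T` family whose `n`-th circuit is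
`q`-local-interacting under some linear ordering of its wires and has depth `≤ c·log₂ n + c` is in
`P`. The printed proof goes through the treewidth of the circuit graph (Prop. 5.1, `r = O(qD)`,
Thm. 4.6); for the DECISION form the content is the light cone of the measured wire (audit note
`scope_caveats (b)` of the catalogue file), and that is the proof formalised here:

1. `LightCone.acceptProb_eq_acceptProb_cone` (`QuantumComplexity/LightCone.lean`): over the unitary
   gate set Clifford+`T` the acceptance probability is that of the backward light cone of wire `0`,
   and `LightCone.card_cone_le`: for a `q`-local circuit of depth `D` that cone has `≤ 2qD + 1`
   wires — here `≤ 2qc log₂ n + 2qc + 1`, so `2^{|S|} ≤ 2^{2qc+1} n^{2qc}`;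
2. the functional simulator (`LightConeSim/SimInit/Decision.lean`): the exact state vector of the
   cone in `ℤ[ω]/√2^h` on its `2^{|S|}` labels, the read-out `2^h p = A + √2 B`, and the integer
   test `W = 10A + 14B − 5·2^h`, positive iff `p ≥ 2/3` under the gap (`decisionW_pos_iff`, using
   the Galois-conjugate run for `|B|`);
3. the machine (`LightConeMachine*.lean`): that simulator as an `FP` string function
   `LightCone.decideF F Q b₀` (`decideF_mem_FP`, from the uniformity of `F`), correct as soon as the
   polynomial yardstick `Q` dominates `2^{|S|} (4N + 42 T + 128)` (`mainF_spec`) — with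
   `Q = 2^{2qc+1} (X + 1)^{2qc} (46 X + 128)` by step 1 (`yardstick_dominates`);
4. `mem_P_of_mem_FP`: an `FP` decider puts the language in `P`.

The identity-ordering form `markovShi2008_cor15` is discharged independently in
`TensorNetworkContractionCor15.lean` (prefix-window front end + the exact `ConeSim` decider); it also
follows from the present theorem by `markovShi2008_cor15_of_anyOrder`.

## References

* I. L. Markov, Y. Shi, *Simulating quantum computation by contracting tensor networks*, SIAM J.
  Comput. 38 (2008) 963–981 (arXiv:quant-ph/0511069), §1 Cor. 1.5 (p. 3: "Let `C` be a quantum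
  circuit of size `T` and depth `D`, and is `q`-local-interacting. Then `C` can be simulated
  deterministically in `T^{O(1)} exp[O(qD)]` time"), §1 after Thm. 1.1 (deterministic simulation =
  exact outcome probabilities), §5 Prop. 5.1 and "`r = O(qD)`". Read via `lit read paper:arxiv-quant-ph_0511069`.
* R. Jozsa, *On the simulation of quantum circuits*, arXiv:quant-ph/0603163, §3.
* M. A. Nielsen, I. L. Chuang, *Quantum Computation and Quantum Information*, CUP 2010, §4.2, Box 4.1.
-/

noncomputable section

open Computability Polynomial Literature.Computability.Complexity Literature.Computability.Complexity.Classes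
  Literature.Computability.Cryptography Literature.Computability.QuantumComplexity
  Literature.Computability.QuantumComplexity.LightCone

namespace Literature.Barriers.QuantumAdvantage

/-- Evaluation of the yardstick polynomial `2^{2qc+1} (X + 1)^{2qc} (46 X + 128)` of the simulator.
[folklore] -/
theorem yardstick_eval (q c t : ℕ) :
    (C (2 ^ (2 * (q * c) + 1)) * (X + 1) ^ (2 * (q * c)) * (C 46 * X + C 128) : Polynomial ℕ).eval t =
      2 ^ (2 * (q * c) + 1) * (t + 1) ^ (2 * (q * c)) * (46 * t + 128) := by
  simp [eval_mul, eval_pow]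

/-- **The cone of a logarithmic-depth `q`-local circuit is polynomially narrow**: if the `|x|`-th
circuit of an oracle-free family is `q`-local under some ordering and has depth
`≤ c log₂ |x| + c`, then `2^{|S|} (4N + 42 T + 128) ≤ Q(|⟨x, d⟩|)`, `Q = 2^{2qc+1} (X + 1)^{2qc} (46 X + 128)`, for the cone
data `⟨S, CC⟩` (`T = |CC|`) of wire `0`. (Markov–Shi 2008, §5, "`r = O(qD)`"; here via
`LightCone.length_coneData_le`.) [folklore] -/
theorem yardstick_dominates {F : QCircuitFamily cliffordT} (hOF : F.IsOracleFree) (q c : ℕ) (x : List Bool)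
    (hx : x ≠ []) (hN : 0 < x.length + F.ancillas x.length)
    (hLoc : ∃ σ : Fin (x.length + F.ancillas x.length) ≃ Fin (x.length + F.ancillas x.length),
      (F.circ x.length).IsLocalInteractingUnder σ q)
    (hD : (F.circ x.length).depth ≤ c * Nat.log 2 x.length + c) :
    2 ^ (coneData F x hN).1.length * (4 * (x.length + F.ancillas x.length) + 42 * (coneData F x hN).2.length + 128) ≤
      (C (2 ^ (2 * (q * c) + 1)) * (X + 1) ^ (2 * (q * c)) * (C 46 * X + C 128) : Polynomial ℕ).eval
        (boolPair x (F.descFn x)).length := by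
  obtain ⟨σ, hσ⟩ := hLoc
  have hn : 0 < x.length := List.length_pos_of_ne_nil hx
  -- width of the cone
  have hS : (coneData F x hN).1.length ≤ 2 * (q * c) * Nat.log 2 x.length + (2 * (q * c) + 1) := by
    have h1 := length_coneData_le hOF hN σ q hσ
    have h2 : q * (F.circ x.length).depth ≤ q * (c * Nat.log 2 x.length + c) := Nat.mul_le_mul_left q hD
    nlinarith
  have h2S : 2 ^ (coneData F x hN).1.length ≤ 2 ^ (2 * (q * c) + 1) * x.length ^ (2 * (q * c)) := by
    calc 2 ^ (coneData F x hN).1.length ≤ 2 ^ (2 * (q * c) * Nat.log 2 x.length + (2 * (q * c) + 1)) :=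
          Nat.pow_le_pow_right (by norm_num) hS
      _ = 2 ^ (2 * (q * c) + 1) * (2 ^ Nat.log 2 x.length) ^ (2 * (q * c)) := by
          rw [pow_add, mul_comm (2 * (q * c)) (Nat.log 2 x.length), pow_mul, mul_comm]
      _ ≤ 2 ^ (2 * (q * c) + 1) * x.length ^ (2 * (q * c)) :=
          Nat.mul_le_mul_left _ (Nat.pow_le_pow_left (Nat.pow_log_le_self 2 hn.ne') _)
  -- the input length dominates the register size and the number of kept gates
  set t := (boolPair x (F.descFn x)).length with ht
  have hdesc := ADH.descFn_eq F x
  have hNt : x.length + F.ancillas x.length ≤ t := by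
    rw [ht, length_boolPair, hdesc, length_boolPair, length_boolPair]
    simp only [ones, List.length_replicate]
    omega
  have hT : (coneData F x hN).2.length ≤ t := by
    have h1 : (coneData F x hN).2.length ≤ (F.circ x.length).gates.length :=
      length_coneL_le (hOF x.length) (List.nodup_singleton _)
    have h2 := ADH.length_gates_le_length_descFn F x
    rw [ht, length_boolPair]; omega
  have hnt : x.length ≤ t + 1 := by omega
  rw [yardstick_eval]
  calc 2 ^ (coneData F x hN).1.length * (4 * (x.length + F.ancillas x.length) + 42 * (coneData F x hN).2.length + 128)
      ≤ (2 ^ (2 * (q * c) + 1) * x.length ^ (2 * (q * c))) * (46 * t + 128) := Nat.mul_le_mul h2S (by omega)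
    _ ≤ (2 ^ (2 * (q * c) + 1) * (t + 1) ^ (2 * (q * c))) * (46 * t + 128) :=
        Nat.mul_le_mul_right _ (Nat.mul_le_mul_left _ (Nat.pow_le_pow_left hnt _))

/-- **Discharge of `markovShi2008_cor15_anyOrder`** (Markov–Shi 2008, Cor. 1.5, language level,
ordering-free locality). Given `q, c`, the family `F` and the language `L` with its gap, the
decider is `LightCone.decideF F Q [[] ∈ L]` with `Q = 2^{2qc+1} (X + 1)^{2qc} (46 X + 128)`: in `FP` by uniformity
(`decideF_mem_FP`), correct on the empty input by construction and on every other input by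
`mainF_spec` (the yardstick dominates by `yardstick_dominates`, i.e. by the logarithmic width of
the light cone of wire `0`) and `decisionW_pos_iff`; `mem_P_of_mem_FP` concludes. The polynomial-size
hypothesis of the fact is not needed (uniformity suffices). [cite: MarkovShi2008, §1 (Cor 1.5) and §5 (Prop 5.1, r = O(qD))] -/
theorem markovShi2008_cor15_anyOrder_holds : markovShi2008_cor15_anyOrder := by
  intro q c F L hOF hU _hPS hLoc hD hDec
  classical
  set Q : Polynomial ℕ := C (2 ^ (2 * (q * c) + 1)) * (X + 1) ^ (2 * (q * c)) * (C 46 * X + C 128) with hQ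
  refine mem_P_of_mem_FP (decideF_mem_FP Q hU (decide ([] ∈ L))) L fun w => ?_
  by_cases hw : w = []
  · subst hw
    rw [decideF_nil]
    by_cases h : ([] : List Bool) ∈ L
    · exact ⟨fun _ => by rw [decide_eq_true h], fun h' => absurd h h'⟩
    · exact ⟨fun h' => absurd h' h, fun _ => by rw [decide_eq_false h]⟩
  · have hn : 0 < w.length := List.length_pos_of_ne_nil hw
    have hN : 0 < w.length + F.ancillas w.length := by omega
    rw [decideF_of_ne_nil Q _ hw,
      mainF_spec Q hOF w hN (yardstick_dominates hOF q c w hw hN (hLoc w.length) (hD w.length))]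
    have hiff := decisionW_pos_iff hOF hN (hDec w)
    constructor
    · intro hwL; rw [decide_eq_true (hiff.2 hwL)]
    · intro hwL; rw [decide_eq_false (fun h => hwL (hiff.1 h))]

end Literature.Barriers.QuantumAdvantage

end
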